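import Summits.RiemannHypothesis.RiemannHypothesis.Theorems.WeilArchPanelsN103ENe103v1D
import HarnessLib

/-!
# G3 A-layer data: panel certificates — window vector `ne103v1` (`v(x) = P(x/b)`, b = 103/100, 30 panels)

Generated by `cert/abgen/panels.py` (prover A g12 cellgen; run by prover A g24 for the SHARP parity-ladder U-side (kernel scale 2^140, Kφ 64, 45-digit panel polynomials, exact per-panel budgets) at b = 103/100; dyadic penalty polynomial in `y = x/b`).
Kernel-checked by `decide +kernel`, each theorem a few seconds. [folklore]
-/

set_option linter.dupNamespace false

namespace Summit.RiemannHypothesis.RiemannHypothesis.Theorems.EvenWinsBeyondArch.ArchN103E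

open Literature.NumberTheory.LFunctions Literature.Analysis.ValidatedNumerics.PolyMP Literature.Analysis.ValidatedNumerics.NumericsMP Literature.Analysis.ValidatedNumerics.ExpPoly

set_option maxHeartbeats 0 in
/-- panel 0. [folklore] -/
theorem ne103v1_pc0 : archPanelCheck 1393796574908163946345982392040522594123776 (1 / 30) 22 14 64 5 20 4 0 (ne103v1Qs.getD 0 []) 1024 (ne103v1ps.getD 0 []) ne103v1E (((103 : ℚ)/100)) (ne103v1Ilo.getD 0 0) (ne103v1Ihi.getD 0 0) = true := by decide +kernel

set_option maxHeartbeats 0 in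
/-- panel 1. [folklore] -/
theorem ne103v1_pc1 : archPanelCheck 1393796574908163946345982392040522594123776 (1 / 30) 22 14 64 5 20 4 1 (ne103v1Qs.getD 1 []) 1024 (ne103v1ps.getD 1 []) ne103v1E (((103 : ℚ)/100)) (ne103v1Ilo.getD 1 0) (ne103v1Ihi.getD 1 0) = true := by decide +kernel

set_option maxHeartbeats 0 in
/-- panel 2. [folklore] -/
theorem ne103v1_pc2 : archPanelCheck 1393796574908163946345982392040522594123776 (1 / 30) 22 14 64 5 20 4 2 (ne103v1Qs.getD 2 []) 1024 (ne103v1ps.getD 2 []) ne103v1E (((103 : ℚ)/100)) (ne103v1Ilo.getD 2 0) (ne103v1Ihi.getD 2 0) = true := by decide +kernel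

set_option maxHeartbeats 0 in
/-- panel 3. [folklore] -/
theorem ne103v1_pc3 : archPanelCheck 1393796574908163946345982392040522594123776 (1 / 30) 22 14 64 5 20 4 3 (ne103v1Qs.getD 3 []) 1024 (ne103v1ps.getD 3 []) ne103v1E (((103 : ℚ)/100)) (ne103v1Ilo.getD 3 0) (ne103v1Ihi.getD 3 0) = true := by decide +kernel

set_option maxHeartbeats 0 in
/-- panel 4. [folklore] -/
theorem ne103v1_pc4 : archPanelCheck 1393796574908163946345982392040522594123776 (1 / 30) 22 14 64 5 20 4 4 (ne103v1Qs.getD 4 []) 1024 (ne103v1ps.getD 4 []) ne103v1E (((103 : ℚ)/100)) (ne103v1Ilo.getD 4 0) (ne103v1Ihi.getD 4 0) = true := by decide +kernel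

set_option maxHeartbeats 0 in
/-- panel 5. [folklore] -/
theorem ne103v1_pc5 : archPanelCheck 1393796574908163946345982392040522594123776 (1 / 30) 22 14 64 5 20 4 5 (ne103v1Qs.getD 5 []) 1024 (ne103v1ps.getD 5 []) ne103v1E (((103 : ℚ)/100)) (ne103v1Ilo.getD 5 0) (ne103v1Ihi.getD 5 0) = true := by decide +kernel

end Summit.RiemannHypothesis.RiemannHypothesis.Theorems.EvenWinsBeyondArch.ArchN103E
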